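import Summits.AtomisticToContinuum.Crystallization.Theorems.TwoCentreKissingKernelRobustTangencyBoundConvexity
import Summits.AtomisticToContinuum.Crystallization.Theorems.TwoCentreKissingKernelRobustTangencyBoundClusterSystem
import HarnessLib

/-!
# `RobustTangencyBound` — the convexity constraint as an `RExpr` (step (III) factory v3)

Route `TwoCentreKissingKernel`, item `stmt-AtomisticToContinuum-12082`.  `cvxR ij ia ja ib jb ab` is the `RExpr` whose evaluation at a point
`q` is `cvxForm (q ij) (q ia) (q ja) (q ib) (q jb) (q ab)` (`eval_cvxR`); it is the inequality
constraint `g ≥ 0` that the certificate systems of factory v3 carry for every long internal edge of a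
cluster complex (`convexity_gram`).  The python replica (`work/factory/cvx.py`, `cvxR`) builds the
identical tree, so the kernel-checked enclosures agree with the search.
-/

namespace Summit.AtomisticToContinuum.Crystallization.Theorems

open Literature.Analysis.ValidatedNumerics

/-- The convexity constraint `cvxForm` on the variables `ij ia ja ib jb ab`, as an `RExpr`. -/
def cvxR (ij ia ja ib jb ab : ℕ) : RExpr :=
  (.sub (.add (.sub (.mul (.const (1)) (.sub (.mul (.const (1)) (.const (1))) (.mul (.var ja)
    (.var ja)))) (.mul (.var ij) (.sub (.mul (.var ij) (.const (1))) (.mul (.var ja) (.var ia)))))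
    (.mul (.var ia) (.sub (.mul (.var ij) (.var ja)) (.mul (.const (1)) (.var ia))))) (.add (.add
    (.mul (.add (.add (.sub (.mul (.const (1)) (.const (1))) (.mul (.var ja) (.var ja))) (.sub
    (.mul (.var ja) (.var ia)) (.mul (.var ij) (.const (1))))) (.sub (.mul (.var ij) (.var ja))
    (.mul (.const (1)) (.var ia)))) (.var ib)) (.mul (.add (.add (.sub (.mul (.var ia) (.var ja))
    (.mul (.var ij) (.const (1)))) (.sub (.mul (.const (1)) (.const (1))) (.mul (.var ia) (.var
    ia)))) (.sub (.mul (.var ij) (.var ia)) (.mul (.const (1)) (.var ja)))) (.var jb))) (.mul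
    (.add (.add (.sub (.mul (.var ij) (.var ja)) (.mul (.var ia) (.const (1)))) (.sub (.mul (.var
    ia) (.var ij)) (.mul (.const (1)) (.var ja)))) (.sub (.mul (.const (1)) (.const (1))) (.mul
    (.var ij) (.var ij)))) (.var ab))))

/-- `cvxR` evaluates to `cvxForm`. -/
theorem eval_cvxR (q : ℕ → ℝ) (ij ia ja ib jb ab : ℕ) :
    (cvxR ij ia ja ib jb ab).eval q = cvxForm (q ij) (q ia) (q ja) (q ib) (q jb) (q ab) := by
  simp only [cvxR, cvxForm, RExpr.eval, Rat.cast_one]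

end Summit.AtomisticToContinuum.Crystallization.Theorems
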